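import Summits.QuantumFields.YangMills.Theorems.BalabanUVNodesN15KingModelCovariantLinkDependence
import HarnessLib

/-!
# BalabanUVNodes ∕ N15 — THE KING-MODEL RUNG (PART Ͱ-o): CONTINUITY OF THE COVARIANT OBJECTS IN THE LINK FIELD — `U ↦ M_U` is continuous (affine), `U ↦ det M_U` is continuous, and on
# the unitary configurations `U ↦ (G_U)_{xy}` is LIPSCHITZ in the sup norm with constant `2(d+1)·c·m⁻⁴` (hence continuous) — the packaging a consumer integrating over the gauge field needs
# (Track A, DAG node N15 = NE2; FAN-OUT v1.1 §N15 s3 «KING-MODEL RUNG»; count-neutral)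

HONEST FRAMING.  Count-neutral (cell `pub-ymgap`, seat `pub-ymgap-dag-n15-e` g42; `--supports stmt-QuantumFields-27247 --as helper` = K3ᴬ, KEY MAP v3).  Bookkeeping over PART Ͱ-a∕Ͱ-g on
King's torus; the link-field space `(T × Fin(d+1)) → Matrix n n 𝕜` carries the Pi sup norm of Mathlib's `L2Operator` matrix norm (scoped); NOT a node discharge; nothing continuum ∕ OS ∕ Clay.

THE RESULTS (`c ≥ 0`, `m² > 0`, fibre `𝕜ⁿ`):
* §1 `continuous_apply_entry`, ★ **`continuous_covLapF`** (`U ↦ −cΔ_U + m²` is continuous — every entry is affine in the link variables, Ͱ-a `covLapF_apply`), ★ **`continuous_det_covLapF`**;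
* §2 ★★ **`norm_blk_inv_sub_blk_inv_le_mul_norm_sub`** — for unitary `U, V`: `‖(G_U)_{xy} − (G_V)_{xy}‖_{op} ≤ 2(d+1)·c·m⁻⁴·‖U − V‖_∞` (Ͱ-g `l2_opNorm_blk_inv_sub_inv_le_of_sup` with
  `ε = ‖U − V‖`, `norm_le_pi_norm`), ★★ **`continuousOn_blk_covLapF_inv`** — `U ↦ (G_U)_{xy}` is continuous on the set of unitary link fields, ★ `continuousOn_covLapF_inv_entry`.

PRIOR TREE ART (by name): Ͱ-a (`covLapF`, `covLapF_apply`), Ͱ-g (`l2_opNorm_blk_inv_sub_inv_le_of_sup`, `blk_sub'`), Ͱ-l∕Ͱ-b entry-vs-block (`norm_entry_le_l2_opNorm_blk` is in Ͱ-l; here a local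
two-line version is avoided by `Metric.continuousOn_iff` on blocks and `continuous_apply` for entries), Mathlib (`continuous_matrix`, `Continuous.matrix_det`, `norm_le_pi_norm`,
`Metric.continuousOn_iff`).  Dedup (rg at filing): basename 0 files; needles `continuous_covLapF|continuousOn_blk_covLapF_inv|norm_blk_inv_sub_blk_inv_le_mul_norm_sub` 0 tree files.
Locators: [Balaban1985BackgroundPropagators] (3.23) p.394, p.398; [King1986] (4.4) p.670.  0 `sorry`, 0 `def`.
-/

noncomputable section

open scoped BigOperators ComplexConjugate ComplexOrder Matrix.Norms.L2Operator Topology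
open Finset Matrix

namespace Summit.QuantumFields.YangMills.BalabanUVNodes.N15KingModelRung.Covariant

open Literature.MathematicalPhysics.QuantumFieldTheory.LatticeDiamagneticInequality (Hopping blk)
open Literature.MathematicalPhysics.QuantumFieldTheory.Balaban1983to89.B5Prop11Plancherel (Tor unitVec)
open Literature.MathematicalPhysics.QuantumFieldTheory.King1986.Torus (lapF)

variable {d : ℕ} (K : Fin (d + 1) → ℕ) [hK : ∀ μ, NeZero (K μ)]
variable {𝕜 : Type*} [RCLike 𝕜] {n : Type*} [Fintype n] [DecidableEq n] {c m2 : ℝ}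

/-! ## §1 Continuity of `U ↦ M_U` and of `U ↦ det M_U` -/

omit hK [Fintype n] [DecidableEq n] in
/-- Evaluating a link field at a bond and an entry is continuous. [folklore] -/
theorem continuous_apply_entry (b : Tor K × Fin (d + 1)) (i j : n) :
    Continuous fun U : Tor K × Fin (d + 1) → Matrix n n 𝕜 => U b i j :=
  (continuous_apply b).matrix_elem i j

omit [Fintype n] in
/-- ★ **`U ↦ −cΔ_U + m²` IS CONTINUOUS** (every entry is an affine function of finitely many link entries, Ͱ-a `covLapF_apply`). [cite: Balaban1985BackgroundPropagators, (3.23) p.394] -/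
theorem continuous_covLapF (c m2 : ℝ) : Continuous fun U : Tor K × Fin (d + 1) → Matrix n n 𝕜 => covLapF K c m2 U := by
  refine continuous_matrix fun p q => ?_
  obtain ⟨x, i⟩ := p
  obtain ⟨y, j⟩ := q
  simp only [covLapF_apply]
  refine continuous_const.sub (continuous_const.mul (continuous_finsetSum _ fun μ _ => Continuous.add ?_ ?_))
  · split_ifs
    · exact continuous_apply_entry K (x, μ) i j
    · exact continuous_const
  · split_ifs
    · simp only [conjTranspose_apply]
      exact continuous_star.comp (continuous_apply_entry K (x - unitVec K μ, μ) j i)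
    · exact continuous_const

/-- ★ **`U ↦ det(−cΔ_U + m²)` IS CONTINUOUS**. [cite: Balaban1982Higgs2, (3.38) p.591] -/
theorem continuous_det_covLapF (c m2 : ℝ) : Continuous fun U : Tor K × Fin (d + 1) → Matrix n n 𝕜 => (covLapF K c m2 U).det :=
  (continuous_covLapF K c m2).matrix_det

/-! ## §2 Lipschitz continuity of `U ↦ (G_U)_{xy}` on the unitary link fields -/

/-- ★★ **LIPSCHITZ IN THE SUP NORM**: for unitary `U, V` (`c ≥ 0`, `m² > 0`), `‖(G_U)_{xy} − (G_V)_{xy}‖_{op} ≤ 2(d+1)·c·(m⁻²·m⁻²)·‖U − V‖` where `‖U − V‖ = sup_b‖U_b − V_b‖_{op}` is the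
Pi sup norm of the link-field difference. [cite: Balaban1985BackgroundPropagators, (3.23) p.394, (3.42) p.397; King1986, (4.4) p.670] -/
theorem norm_blk_inv_sub_blk_inv_le_mul_norm_sub (hc : 0 ≤ c) (hm : 0 < m2) {U V : Tor K × Fin (d + 1) → Matrix n n 𝕜}
    (hU : ∀ b, U b ∈ Matrix.unitaryGroup n 𝕜) (hV : ∀ b, V b ∈ Matrix.unitaryGroup n 𝕜) (x y : Tor K) :
    ‖blk ((covLapF K c m2 U)⁻¹) x y - blk ((covLapF K c m2 V)⁻¹) x y‖ ≤ 2 * ((d : ℝ) + 1) * c * (m2⁻¹ * m2⁻¹) * ‖U - V‖ := by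
  have h := l2_opNorm_blk_inv_sub_inv_le_of_sup K hc hm hU hV (ε := ‖U - V‖) (fun b => by simpa only [Pi.sub_apply] using norm_le_pi_norm (U - V) b) x y
  rw [blk_sub'] at h
  calc _ ≤ 2 * ((d : ℝ) + 1) * c * ‖U - V‖ * (m2⁻¹ * m2⁻¹) := h
    _ = 2 * ((d : ℝ) + 1) * c * (m2⁻¹ * m2⁻¹) * ‖U - V‖ := by ring

/-- ★★ **`U ↦ (G_U)_{xy}` IS CONTINUOUS ON THE UNITARY LINK FIELDS** (Lipschitz ⟹ continuous within the set). [cite: Balaban1985BackgroundPropagators, (3.23) p.394] -/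
theorem continuousOn_blk_covLapF_inv (hc : 0 ≤ c) (hm : 0 < m2) (x y : Tor K) :
    ContinuousOn (fun U : Tor K × Fin (d + 1) → Matrix n n 𝕜 => blk ((covLapF K c m2 U)⁻¹) x y) {U | ∀ b, U b ∈ Matrix.unitaryGroup n 𝕜} := by
  set C := 2 * ((d : ℝ) + 1) * c * (m2⁻¹ * m2⁻¹) with hCdef
  have hC : 0 ≤ C := by rw [hCdef]; positivity
  refine Metric.continuousOn_iff.mpr fun U hU ε hε => ⟨ε / (C + 1), div_pos hε (by linarith), fun V hV hVU => ?_⟩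
  rw [dist_eq_norm] at hVU ⊢
  calc ‖blk ((covLapF K c m2 V)⁻¹) x y - blk ((covLapF K c m2 U)⁻¹) x y‖ ≤ C * ‖V - U‖ := norm_blk_inv_sub_blk_inv_le_mul_norm_sub K hc hm hV hU x y
    _ ≤ C * (ε / (C + 1)) := mul_le_mul_of_nonneg_left hVU.le hC
    _ < ε := by
        rw [mul_div_assoc']
        rw [div_lt_iff₀ (by linarith)]
        nlinarith

/-- ★ … and so is every entry `U ↦ G_U((x,i),(y,j))`. [cite: Balaban1985BackgroundPropagators, (3.23) p.394] -/
theorem continuousOn_covLapF_inv_entry (hc : 0 ≤ c) (hm : 0 < m2) (x y : Tor K) (i j : n) :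
    ContinuousOn (fun U : Tor K × Fin (d + 1) → Matrix n n 𝕜 => (covLapF K c m2 U)⁻¹ (x, i) (y, j)) {U | ∀ b, U b ∈ Matrix.unitaryGroup n 𝕜} := by
  have h := continuousOn_blk_covLapF_inv K (n := n) (𝕜 := 𝕜) hc hm x y
  have he : (fun U : Tor K × Fin (d + 1) → Matrix n n 𝕜 => (covLapF K c m2 U)⁻¹ (x, i) (y, j))
      = (fun A : Matrix n n 𝕜 => A i j) ∘ (fun U => blk ((covLapF K c m2 U)⁻¹) x y) := by
    funext U; simp [blk]
  rw [he]
  exact ((continuous_id.matrix_elem i j).continuousOn (s := Set.univ)).comp h (fun _ _ => Set.mem_univ _)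

end Summit.QuantumFields.YangMills.BalabanUVNodes.N15KingModelRung.Covariant

end
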